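import Mathlib
import Literature.NumberTheory.Irrationality.BrownZudilin2022.BarnesRepresentation
import Summits.KontsevichZagierPeriods.Zeta5Search.BarnesDouble
import HarnessLib

/-!
# ζ(5) search — when is the chamber of (16) non-empty? (cell `pub-zeta5`, seat ct-1 g11)

HONEST FRAMING: systematic search; no irrationality claim unless kernel-certified. Nothing in this file is an
irrationality result, a worthiness exponent or a denominator statement. Brown–Zudilin's Barnes representation (16)
[BrownZudilin2022, Sect. 5] is stated for abscissae `0 < c₁ < 1+min{p₀,p₁,p₂}`, `0 < c₂ < 1+min{p₄,p₅,p₆}`,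
`1+p₀+p₆−q₃ < c₁+c₂ < p₃+2` (`Chamber`). This file turns the real-quantified hypothesis "there is a chamber point" of
`BarnesDouble.barnes_double_holds` (and of the symmetry theorems of `BarnesSymmetry.lean`) into four INTEGER inequalities
on `(p;q)` (`chamber_exists`), with an explicit witness, and records the resulting integer-hypothesis form of (16)
(`barnes_double_of_ineq`). Theorems only (no new definitions).
-/

noncomputable section

namespace Summit.KontsevichZagierPeriods.Zeta5Search.BarnesChamber

open MeasureTheory Set
open scoped Real
open Literature.NumberTheory.Irrationality.BrownZudilin2022
open Summit.KontsevichZagierPeriods.Zeta5Search.BarnesDouble (barnes_double_holds)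

/-- **The chamber is non-empty iff four integer inequalities hold** (the 'if' direction, with an explicit witness):
if `m := min{p₀,p₁,p₂} ≥ 0`, `m' := min{p₄,p₅,p₆} ≥ 0`, `p₃ ≥ 0`, `1+p₀+p₆−q₃ < p₃+2` and `1+p₀+p₆−q₃ < 2+m+m'`, then
`c₁ = θ(1+m)`, `c₂ = θ(1+m')` with `θ = (L+U)/(2(2+m+m'))`, `L = max(1+p₀+p₆−q₃, 0)`, `U = min(p₃+2, 2+m+m')`, is a chamber point. -/
theorem chamber_exists (p : Fin 7 → ℤ) (q : Fin 5 → ℤ) (h0 : 0 ≤ min (p 0) (min (p 1) (p 2)))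
    (h4 : 0 ≤ min (p 4) (min (p 5) (p 6))) (h3 : 0 ≤ p 3) (hhi : 1 + p 0 + p 6 - q 2 < p 3 + 2)
    (hS : 1 + p 0 + p 6 - q 2 < 2 + min (p 0) (min (p 1) (p 2)) + min (p 4) (min (p 5) (p 6))) :
    ∃ c₁ c₂ : ℝ, Chamber p q c₁ c₂ := by
  have hm0 : (0 : ℝ) ≤ ((min (p 0) (min (p 1) (p 2)) : ℤ) : ℝ) := by exact_mod_cast h0
  have hm0' : (0 : ℝ) ≤ ((min (p 4) (min (p 5) (p 6)) : ℤ) : ℝ) := by exact_mod_cast h4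
  set L : ℝ := max ((1 : ℝ) + p 0 + p 6 - q 2) 0 with hL
  set S : ℝ := 2 + ((min (p 0) (min (p 1) (p 2)) : ℤ) : ℝ) + ((min (p 4) (min (p 5) (p 6)) : ℤ) : ℝ) with hSdef
  set U : ℝ := min ((p 3 : ℝ) + 2) S with hU
  have hLU : L < U := by
    have h1 : ((1 : ℝ) + p 0 + p 6 - q 2) < (p 3 : ℝ) + 2 := by exact_mod_cast hhi
    have h2 : ((1 : ℝ) + p 0 + p 6 - q 2) < S := by rw [hSdef]; exact_mod_cast hS
    have h3' : (0 : ℝ) < (p 3 : ℝ) + 2 := by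
      have : (0 : ℝ) ≤ (p 3 : ℝ) := by exact_mod_cast h3
      linarith
    rw [hL, hU]
    exact max_lt (lt_min h1 h2) (lt_min h3' (by linarith))
  have hL0 : 0 ≤ L := le_max_right _ _
  have hUS : U ≤ S := min_le_right _ _
  have hSpos : 0 < S := by linarith
  set θ : ℝ := (L + U) / (2 * S) with hθ
  have hθpos : 0 < θ := by rw [hθ]; exact div_pos (by linarith) (by linarith)
  have hθlt : θ < 1 := by rw [hθ, div_lt_one (by linarith)]; linarith
  have hsum : θ * (1 + ((min (p 0) (min (p 1) (p 2)) : ℤ) : ℝ)) + θ * (1 + ((min (p 4) (min (p 5) (p 6)) : ℤ) : ℝ)) =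
      (L + U) / 2 := by
    rw [hθ]; field_simp; ring
  refine ⟨θ * (1 + ((min (p 0) (min (p 1) (p 2)) : ℤ) : ℝ)), θ * (1 + ((min (p 4) (min (p 5) (p 6)) : ℤ) : ℝ)),
    by positivity, ?_, by positivity, ?_, ?_, ?_⟩
  · have : θ * (1 + ((min (p 0) (min (p 1) (p 2)) : ℤ) : ℝ)) < 1 * (1 + ((min (p 0) (min (p 1) (p 2)) : ℤ) : ℝ)) :=
      mul_lt_mul_of_pos_right hθlt (by linarith)
    linarith
  · have : θ * (1 + ((min (p 4) (min (p 5) (p 6)) : ℤ) : ℝ)) < 1 * (1 + ((min (p 4) (min (p 5) (p 6)) : ℤ) : ℝ)) :=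
      mul_lt_mul_of_pos_right hθlt (by linarith)
    linarith
  · rw [hsum]
    have : ((1 : ℝ) + p 0 + p 6 - q 2) ≤ L := le_max_left _ _
    linarith
  · rw [hsum]
    have : U ≤ (p 3 : ℝ) + 2 := min_le_left _ _
    linarith

/-- **(16) with integer hypotheses only**: for `p, q ≥ 0` with `1+p₀+p₆−q₃ < p₃+2` and
`1+p₀+p₆−q₃ < 2+min{p₀,p₁,p₂}+min{p₄,p₅,p₆}` there is a chamber point, and there (16) holds
(`BarnesDouble.barnes_double_holds`). [BrownZudilin2022, Sect. 5, eq. (16)] -/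
theorem barnes_double_of_ineq (p : Fin 7 → ℤ) (q : Fin 5 → ℤ) (hp : ∀ i, 0 ≤ p i) (hq : ∀ j, 0 ≤ q j)
    (hhi : 1 + p 0 + p 6 - q 2 < p 3 + 2)
    (hS : 1 + p 0 + p 6 - q 2 < 2 + min (p 0) (min (p 1) (p 2)) + min (p 4) (min (p 5) (p 6))) :
    ∃ c₁ c₂ : ℝ, Chamber p q c₁ c₂ ∧
      Integrable (fun y : ℝ × ℝ => barnesKernel p q (-(c₁ : ℂ) + (y.1 : ℂ) * Complex.I) (-(c₂ : ℂ) + (y.2 : ℂ) * Complex.I)) ∧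
      (Jintegral p q : ℂ) = (barnesPrefactor p q : ℂ) * ((4 : ℂ) * (Real.pi : ℂ) ^ 2)⁻¹ *
        ∫ y : ℝ × ℝ, barnesKernel p q (-(c₁ : ℂ) + (y.1 : ℂ) * Complex.I) (-(c₂ : ℂ) + (y.2 : ℂ) * Complex.I) := by
  have h0 : 0 ≤ min (p 0) (min (p 1) (p 2)) := le_min (hp 0) (le_min (hp 1) (hp 2))
  have h4 : 0 ≤ min (p 4) (min (p 5) (p 6)) := le_min (hp 4) (le_min (hp 5) (hp 6))
  obtain ⟨c₁, c₂, hch⟩ := chamber_exists p q h0 h4 (hp 3) hhi hS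
  exact ⟨c₁, c₂, hch, barnes_double_holds p q c₁ c₂ hp hq hch⟩

end Summit.KontsevichZagierPeriods.Zeta5Search.BarnesChamber

end
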